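import Mathlib
import HarnessLib
import Literature.MathematicalPhysics.KineticTheory.VelocityFlipNoise
import Literature.MathematicalPhysics.KineticTheory.VelocityFlipEmbeddedChainSteadyState
import Literature.MathematicalPhysics.KineticTheory.LangevinChainDynkin
import Literature.MathematicalPhysics.KineticTheory.LangevinChainGibbs
import Summits.AtomisticToContinuum.FouriersLaw.Theorems.BondHeatUncertaintySubdiffusiveBondHeatKernelGibbsE

/-!
# The continuous representative of a mild forward field is again mild (stub UPGRADE)

`--supports stmt-AtomisticToContinuum-11976` helper file (crux `VanishingNoiseBound`, route
`VanishingNoiseTransfer`, line `fekete-usc-one-length`, stub UPGRADE `stub_flipSmoothMildUpgrade`, wave 5).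

For the pinned chain `pinnedChain ω₂ lam β γ` (all parameters `> 0`), `L ≥ 2`, `T > 0`, `ε > 0`, a constant `c`,
let `R = R_{Lε}` be the resolvent kernel of the flip-free EQUILIBRIUM dynamics at bath temperatures `(T, T)`,
`ψ = (Lε)⁻¹((p_0² − T) − c)` and `Q g = L⁻¹ Σ_i g ∘ momentumFlip i`. If a measurable `e^{H/(4T)}`-bounded `g`
solves the centred mild Poisson equation `g = R(ψ + Q g)` pointwise and `g'` is CONTINUOUS with `g = g'`
Lebesgue-a.e., then `g'` is `e^{H/(4T)}`-bounded EVERYWHERE and ITSELF solves `g' = R(ψ + Q g')` pointwise: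

* `abs_le_of_ae_eq_of_continuous` — a continuous function a.e. equal to a function below a continuous bound is
  below that bound everywhere (Lebesgue measure charges open sets);
* `pinnedChain_continuous_integral_resolventKernel_of_abs_le_exp` — the Feller property of `R_r` on CONTINUOUS
  `e^{θH}`-bounded observables (`2θ < 1/max(T_L,T_R)`): energy truncation to bounded continuous functions
  (`LangevinChainSemigroup.continuous_integral_resolventKernel`, `continuous_act_pinnedChainSemigroup`) with the
  tail controlled locally uniformly by the Lyapunov bound `R_r e^{2θH} ≤ a e^{2θH} + b`
  (`pinnedChain_lintegral_exp_hamiltonian_resolventKernel_le`);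
* `pinnedChain_volume_absolutelyContinuous_gibbsMeasure` — `volume ≪ μ_T` (positive density);
* `bind_resolventKernel_of_isInvariant` — a finite invariant measure of a Langevin-chain semigroup is invariant for
  its named resolvent kernels `R_r`, `r > 0` (Tonelli; the named-kernel form of
  `FixedLengthNoiseContinuity.isInvariant_resolvent`);
* `flip_smoothMildUpgrade` / `stub_flipSmoothMildUpgrade` — the statement: `ĝ := R(ψ + Q g')` is continuous,
  `ĝ = g` off a Lebesgue-null set because `Q g' = Q g` a.e. (flips preserve volume), `μ_T R = μ_T`
  (`bind_resolventKernel_of_isInvariant` + `pinnedChainSemigroup_isInvariant_gibbsMeasure`) and `μ_T ∼ volume`;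
  two continuous a.e.-equal functions coincide.

References: Ethier–Kurtz 1986 Ch. 1 §2 (resolvents); Bernardin–Olla 2011 §2.1; Cuneo–Eckmann–Hairer–Rey-Bellet
2018 §3.
-/

noncomputable section

open MeasureTheory ProbabilityTheory Filter Topology Set
open scoped NNReal ENNReal Topology BoundedContinuousFunction
open Literature.MathematicalPhysics.KineticTheory.HeatConduction OscillatorChain
open Summit.AtomisticToContinuum.FouriersLaw.Theorems.SubdiffusiveBondHeat (abs_sq_momentum_sub_le_exp
  pinnedChainSemigroup_isInvariant_gibbsMeasure integrable_of_abs_le_exp)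

namespace Summit.AtomisticToContinuum.FouriersLaw.Theorems.VanishingNoiseBound

section Upgrade

variable {ω₂ lam β γ : ℝ} {N : ℕ}

/-- A continuous function which agrees Lebesgue-a.e. with a function dominated by a continuous bound is
dominated by that bound everywhere: the excess `max (|g'| − B) 0` is continuous and a.e. zero, hence zero
(Lebesgue measure on phase space charges open sets). -/
theorem abs_le_of_ae_eq_of_continuous {g g' B : PhaseSpace N → ℝ} (hg' : Continuous g') (hB : Continuous B)
    (hgB : ∀ z, |g z| ≤ B z) (hae : ∀ᵐ x ∂(volume : Measure (PhaseSpace N)), g x = g' x) (z : PhaseSpace N) :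
    |g' z| ≤ B z := by
  haveI := isAddHaarMeasure_volume_phaseSpace N
  have hh : (fun x => max (|g' x| - B x) 0) =ᵐ[(volume : Measure (PhaseSpace N))] fun _ => (0 : ℝ) := by
    filter_upwards [hae] with x hx
    rw [← hx]
    exact max_eq_right (by linarith [hgB x])
  have heq := (Continuous.ae_eq_iff_eq volume ((continuous_abs.comp hg').sub hB |>.max continuous_const)
    continuous_const).1 hh
  have hz : max (|g' z| - B z) 0 = 0 := congr_fun heq z
  linarith [max_eq_right_iff.1 hz]

/-- **Feller property of the resolvent kernel on exponentially bounded continuous observables** (pinned chain,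
all parameters `> 0`, `N ≥ 2`, `T_L, T_R > 0`, `r > 0`, `θ > 0` with `2θ < 1/max(T_L,T_R)`): for continuous `f`
with `|f| ≤ C e^{θH}`, `z ↦ ∫ f dR_r(z, ·)` is continuous. Truncate `f_M = f · χ_M(H)` with a continuous cutoff
(`χ_M = 1` on `{H ≤ M}`, `= 0` on `{H ≥ M + 1}`) to a bounded continuous function, whose resolvent image is
continuous (`continuous_integral_resolventKernel` + `continuous_act_pinnedChainSemigroup`), and bound the tail
`|∫ (f − f_M) dR_r(z,·)| ≤ C e^{−θM} ∫ e^{2θH} dR_r(z,·) ≤ C e^{−θM} (e^{2θH(z)} + b)` by the Lyapunov bound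
`pinnedChain_lintegral_exp_hamiltonian_resolventKernel_le`, locally uniformly in `z`. -/
theorem pinnedChain_continuous_integral_resolventKernel_of_abs_le_exp (hω : 0 < ω₂) (hl : 0 < lam)
    (hβ : 0 < β) (hγ : 0 < γ) (hN : 1 < N) {T_L T_R : ℝ} (hTL : 0 < T_L) (hTR : 0 < T_R) {r : ℝ} (hr : 0 < r)
    {θ : ℝ} (hθ : 0 < θ) (hθ2 : 2 * θ < 1 / max T_L T_R) {f : PhaseSpace N → ℝ} (hf : Continuous f) {C : ℝ}
    (hC : ∀ y, |f y| ≤ C * Real.exp (θ * (pinnedChain ω₂ lam β γ).hamiltonian N y)) :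
    Continuous fun z => ∫ y, f y ∂((pinnedChainSemigroup hω hl.le hβ.le hγ.le (Nat.zero_lt_of_lt hN) hTL.le
      hTR.le).resolventKernel r z) := by
  have hN0 : 0 < N := Nat.zero_lt_of_lt hN
  set P := pinnedChain ω₂ lam β γ with hP
  set Sg := pinnedChainSemigroup hω hl.le hβ.le hγ.le hN0 hTL.le hTR.le with hSg
  set R := Sg.resolventKernel r with hRdef
  haveI hRM : IsMarkovKernel R := Sg.isMarkovKernel_resolventKernel hr
  set H : PhaseSpace N → ℝ := P.hamiltonian N with hH
  have hHc : Continuous H := pinnedChain_continuous_hamiltonian ω₂ lam β γ N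
  have hH0 : ∀ x, 0 ≤ H x := fun x => pinnedChain_hamiltonian_nonneg hω.le hl.le hβ.le γ N x
  have hC0 : 0 ≤ C := nonneg_of_mul_nonneg_left ((abs_nonneg _).trans (hC 0)) (Real.exp_pos _)
  -- the Lyapunov bound at weight `e^{2θH}`
  obtain ⟨a, b, ha, hb, hly⟩ :=
    pinnedChain_lintegral_exp_hamiltonian_resolventKernel_le hω hl hβ hγ hN hTL hTR hr (by positivity) hθ2
  -- the Feller property on bounded continuous functions
  have hfeller : ∀ g : PhaseSpace N →ᵇ ℝ, Continuous fun z => ∫ y, g y ∂(R z) := fun g =>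
    Sg.continuous_integral_resolventKernel hr
      (continuous_act_pinnedChainSemigroup hω hl.le hβ.le hγ.le hN0 hTL.le hTR.le) g
  -- integrability of `e^{2θH}` and of `f` against `R z`
  have hexpint : ∀ z, Integrable (fun y => Real.exp (2 * θ * H y)) (R z) := by
    intro z
    refine ⟨(Real.continuous_exp.comp (continuous_const.mul hHc)).aestronglyMeasurable, ?_⟩
    rw [hasFiniteIntegral_iff_ofReal (Eventually.of_forall fun y => (Real.exp_pos _).le)]
    refine (hly z).trans_lt ?_
    exact ENNReal.add_lt_top.2 ⟨ENNReal.mul_lt_top (ha.trans_le le_top) ENNReal.ofReal_lt_top, hb.lt_top⟩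
  have hθ2θ : ∀ y, Real.exp (θ * H y) ≤ Real.exp (2 * θ * H y) := fun y =>
    Real.exp_le_exp.2 (by nlinarith [hH0 y, hθ])
  have hC2 : ∀ y, |f y| ≤ C * Real.exp (2 * θ * H y) := fun y =>
    (hC y).trans (mul_le_mul_of_nonneg_left (hθ2θ y) hC0)
  have hfint : ∀ z, Integrable f (R z) := fun z => integrable_of_abs_le_exp (hexpint z) hf hC2
  -- the continuous cutoff and the truncations
  set χ : ℝ → ℝ → ℝ := fun M h => min 1 (max 0 (M + 1 - h)) with hχ
  have hχc : ∀ M, Continuous (χ M) := fun M => by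
    simp only [hχ]
    fun_prop
  have hχ01 : ∀ M h, 0 ≤ χ M h ∧ χ M h ≤ 1 := fun M h =>
    ⟨le_min zero_le_one (le_max_left _ _), min_le_left _ _⟩
  have hχ1 : ∀ M h, h ≤ M → χ M h = 1 := fun M h hle => by
    simp only [hχ]
    exact min_eq_left (le_max_of_le_right (by linarith))
  have hχ0 : ∀ M h, M + 1 ≤ h → χ M h = 0 := fun M h hle => by
    simp only [hχ]
    rw [max_eq_left (by linarith), min_eq_right zero_le_one]
  set fM : ℝ → PhaseSpace N → ℝ := fun M y => f y * χ M (H y) with hfM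
  have hfMc : ∀ M, Continuous (fM M) := fun M => hf.mul ((hχc M).comp hHc)
  have hfMb : ∀ M y, ‖fM M y‖ ≤ C * Real.exp (θ * (M + 1)) := by
    intro M y
    rw [Real.norm_eq_abs, hfM]
    dsimp only
    rw [abs_mul, abs_of_nonneg (hχ01 M (H y)).1]
    by_cases hy : H y ≤ M + 1
    · calc |f y| * χ M (H y) ≤ C * Real.exp (θ * H y) * 1 :=
            mul_le_mul (hC y) (hχ01 M _).2 (hχ01 M _).1 (by positivity)
        _ ≤ C * Real.exp (θ * (M + 1)) := by
            rw [mul_one]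
            exact mul_le_mul_of_nonneg_left (Real.exp_le_exp.2 (mul_le_mul_of_nonneg_left hy hθ.le)) hC0
    · rw [hχ0 M (H y) (le_of_not_ge hy), mul_zero]
      positivity
  have hfMle : ∀ M y, |fM M y| ≤ C * Real.exp (2 * θ * H y) := by
    intro M y
    rw [hfM]
    dsimp only
    rw [abs_mul, abs_of_nonneg (hχ01 M (H y)).1]
    calc |f y| * χ M (H y) ≤ |f y| * 1 := mul_le_mul_of_nonneg_left (hχ01 M _).2 (abs_nonneg _)
      _ ≤ C * Real.exp (2 * θ * H y) := by rw [mul_one]; exact hC2 y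
  have hFMc : ∀ M, Continuous fun z => ∫ y, fM M y ∂(R z) := fun M =>
    hfeller (BoundedContinuousFunction.ofNormedAddCommGroup (fM M) (hfMc M) _ (hfMb M))
  -- the tail: `|f − f_M| ≤ C e^{−θM} e^{2θH}`
  have htail : ∀ M y, |f y - fM M y| ≤ C * Real.exp (-(θ * M)) * Real.exp (2 * θ * H y) := by
    intro M y
    rw [hfM]
    dsimp only
    rw [← mul_one_sub, abs_mul]
    by_cases hy : H y ≤ M
    · rw [hχ1 M (H y) hy, sub_self, abs_zero, mul_zero]
      positivity
    · have h1 : |1 - χ M (H y)| ≤ 1 := by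
        rw [abs_le]
        constructor <;> linarith [(hχ01 M (H y)).1, (hχ01 M (H y)).2]
      have h2 : Real.exp (θ * H y) ≤ Real.exp (-(θ * M)) * Real.exp (2 * θ * H y) := by
        rw [← Real.exp_add]
        exact Real.exp_le_exp.2 (by nlinarith [le_of_not_ge hy, hθ])
      calc |f y| * |1 - χ M (H y)| ≤ C * Real.exp (θ * H y) * 1 :=
            mul_le_mul (hC y) h1 (abs_nonneg _) (by positivity)
        _ ≤ C * (Real.exp (-(θ * M)) * Real.exp (2 * θ * H y)) := by
            rw [mul_one]
            exact mul_le_mul_of_nonneg_left h2 hC0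
        _ = C * Real.exp (-(θ * M)) * Real.exp (2 * θ * H y) := by ring
  -- the error of the truncation, pointwise in `z`
  have herr : ∀ M z, |∫ y, f y ∂(R z) - ∫ y, fM M y ∂(R z)| ≤
      C * Real.exp (-(θ * M)) * (Real.exp (2 * θ * H z) + b.toReal) := by
    intro M z
    have hfMint : Integrable (fM M) (R z) := integrable_of_abs_le_exp (hexpint z) (hfMc M) (hfMle M)
    rw [← integral_sub (hfint z) hfMint]
    have hbi : Integrable (fun y => C * Real.exp (-(θ * M)) * Real.exp (2 * θ * H y)) (R z) :=
      (hexpint z).const_mul _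
    have h1 := norm_integral_le_of_norm_le hbi (Eventually.of_forall fun y => by
      rw [Real.norm_eq_abs]; exact htail M y)
    rw [Real.norm_eq_abs, integral_const_mul] at h1
    refine h1.trans (mul_le_mul_of_nonneg_left ?_ (by positivity))
    rw [integral_eq_lintegral_of_nonneg_ae (Eventually.of_forall fun y => (Real.exp_pos _).le)
      (hexpint z).aestronglyMeasurable]
    have h3 : a * ENNReal.ofReal (Real.exp (2 * θ * H z)) + b ≤ ENNReal.ofReal (Real.exp (2 * θ * H z)) + b := by
      gcongr
      exact mul_le_of_le_one_left zero_le ha.le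
    calc (∫⁻ y, ENNReal.ofReal (Real.exp (2 * θ * H y)) ∂(R z)).toReal
        ≤ (ENNReal.ofReal (Real.exp (2 * θ * H z)) + b).toReal :=
          ENNReal.toReal_mono (ENNReal.add_ne_top.2 ⟨ENNReal.ofReal_ne_top, hb⟩) ((hly z).trans h3)
      _ = Real.exp (2 * θ * H z) + b.toReal := by
          rw [ENNReal.toReal_add ENNReal.ofReal_ne_top hb, ENNReal.toReal_ofReal (Real.exp_pos _).le]
  -- conclusion: a locally uniform limit of continuous functions
  refine continuous_of_locally_uniform_approx_of_continuousAt fun z₀ u hu => ?_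
  obtain ⟨ε, hε, hεu⟩ := Metric.mem_uniformity_dist.1 hu
  refine ⟨{z | H z < H z₀ + 1}, (isOpen_lt hHc continuous_const).mem_nhds (by simp), ?_⟩
  set K : ℝ := Real.exp (2 * θ * (H z₀ + 1)) + b.toReal with hK
  have htend : Tendsto (fun M : ℝ => C * Real.exp (-(θ * M)) * K) atTop (𝓝 0) := by
    have h1 : Tendsto (fun M : ℝ => Real.exp (-(θ * M))) atTop (𝓝 0) :=
      Real.tendsto_exp_neg_atTop_nhds_zero.comp (tendsto_id.const_mul_atTop hθ)
    simpa using (h1.const_mul C).mul_const K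
  obtain ⟨M, hM⟩ := (htend.eventually (gt_mem_nhds hε)).exists
  refine ⟨fun z => ∫ y, fM M y ∂(R z), (hFMc M).continuousAt, fun z hz => hεu ?_⟩
  rw [Real.dist_eq]
  refine (herr M z).trans_lt (lt_of_le_of_lt (mul_le_mul_of_nonneg_left ?_ (by positivity)) hM)
  rw [hK]
  gcongr
  exact le_of_lt hz

/-- Lebesgue measure on phase space is absolutely continuous with respect to the Gibbs measure of the pinned chain
(`T > 0`): the Gibbs density `e^{−H/T}` is positive and integrable. -/
theorem pinnedChain_volume_absolutelyContinuous_gibbsMeasure (hω : 0 < ω₂) (hl : 0 ≤ lam) (hβ : 0 ≤ β) (γ : ℝ)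
    (N : ℕ) {T : ℝ} (hT : 0 < T) :
    (volume : Measure (PhaseSpace N)) ≪ (pinnedChain ω₂ lam β γ).gibbsMeasure N T := by
  rw [OscillatorChain.gibbsMeasure_eq]
  exact absolutelyContinuous_tilted (pinnedChain_integrable_gibbsDensity hω hl hβ γ N hT)

/-- **A finite invariant measure of the semigroup is invariant for the named resolvent kernels**: if `μ P_t = μ`
for all `t ≥ 0` then `μ R_r = μ` for `r > 0`, since `R_r(z, A) = ∫ P_{t⁺}(z, A) Exp_r(dt)` (Tonelli). -/
theorem bind_resolventKernel_of_isInvariant {P : OscillatorChain} {T_L T_R : ℝ}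
    (S : LangevinChainSemigroup P N T_L T_R) {r : ℝ} (hr : 0 < r) {μ : Measure (PhaseSpace N)}
    [IsFiniteMeasure μ] (hμ : S.IsInvariant μ) : μ.bind (S.resolventKernel r) = μ := by
  -- adapted from `FixedLengthNoiseContinuity.isInvariant_resolvent`
  -- (Summits/…/VanishingNoiseTransferVanishingNoiseBoundFlipResolventInvariant.lean), for the named kernel
  haveI := isProbabilityMeasure_expMeasure hr
  haveI := S.isMarkovKernel_resolventKernel hr
  refine Measure.ext fun s hs => ?_
  rw [Measure.bind_apply hs (Kernel.aemeasurable _)]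
  have hmeas : Measurable fun p : PhaseSpace N × ℝ => S.timeKernel (p.2, p.1) s :=
    (Kernel.measurable_coe S.timeKernel hs).comp measurable_swap
  calc ∫⁻ z, S.resolventKernel r z s ∂μ = ∫⁻ z, ∫⁻ t, S.timeKernel (t, z) s ∂(expMeasure r) ∂μ :=
        lintegral_congr fun z => S.resolventKernel_apply hr z hs
    _ = ∫⁻ t, ∫⁻ z, S.timeKernel (t, z) s ∂μ ∂(expMeasure r) := lintegral_lintegral_swap hmeas.aemeasurable
    _ = ∫⁻ _t, μ s ∂(expMeasure r) :=
        lintegral_congr fun t => LangevinChainSemigroup.IsInvariant.lintegral_kernel S hμ t.toNNReal hs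
    _ = μ s := by rw [lintegral_const, measure_univ, mul_one]

/-- **The continuous representative of a mild forward field is mild** (pinned chain, all parameters `> 0`,
`L ≥ 2`, `T > 0`, `ε > 0`, equal bath temperatures `(T, T)`). See the module docstring. -/
theorem flip_smoothMildUpgrade (hω : 0 < ω₂) (hl : 0 < lam) (hβ : 0 < β) (hγ : 0 < γ) {L : ℕ} (hL : 2 ≤ L)
    {T : ℝ} (hT : 0 < T) {ε : ℝ} (hε : 0 < ε) (c : ℝ) {g g' : PhaseSpace L → ℝ}
    (hgb : ∃ C : ℝ, ∀ z, |g z| ≤ C * Real.exp (1 / (4 * T) * (pinnedChain ω₂ lam β γ).hamiltonian L z))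
    (hmild : ∀ z, g z = ∫ y, (((L : ℝ) * ε)⁻¹ * ((y.2 ⟨0, by omega⟩ ^ 2 - T) - c) +
        (L : ℝ)⁻¹ * ∑ i : Fin L, g (momentumFlip i y))
      ∂((pinnedChainSemigroup hω hl.le hβ.le hγ.le (by omega) hT.le hT.le).resolventKernel ((L : ℝ) * ε) z))
    (hg'c : Continuous g') (hae : ∀ᵐ x ∂(volume : Measure (PhaseSpace L)), g x = g' x) :
    (∃ C : ℝ, ∀ z, |g' z| ≤ C * Real.exp (1 / (4 * T) * (pinnedChain ω₂ lam β γ).hamiltonian L z)) ∧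
      ∀ z, g' z = ∫ y, (((L : ℝ) * ε)⁻¹ * ((y.2 ⟨0, by omega⟩ ^ 2 - T) - c) +
          (L : ℝ)⁻¹ * ∑ i : Fin L, g' (momentumFlip i y))
        ∂((pinnedChainSemigroup hω hl.le hβ.le hγ.le (by omega) hT.le hT.le).resolventKernel ((L : ℝ) * ε) z) := by
  have hL0 : 0 < L := by omega
  have hL1 : 1 < L := by omega
  set P := pinnedChain ω₂ lam β γ with hP
  set Sg := pinnedChainSemigroup hω hl.le hβ.le hγ.le hL0 hT.le hT.le with hSg
  set r : ℝ := (L : ℝ) * ε with hr_def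
  have hr : 0 < r := by positivity
  set R := Sg.resolventKernel r with hRdef
  haveI hRM : IsMarkovKernel R := Sg.isMarkovKernel_resolventKernel hr
  set H : PhaseSpace L → ℝ := P.hamiltonian L with hH
  have hHc : Continuous H := pinnedChain_continuous_hamiltonian ω₂ lam β γ L
  have hH0 : ∀ x, 0 ≤ H x := fun x => pinnedChain_hamiltonian_nonneg hω.le hl.le hβ.le γ L x
  set θ : ℝ := 1 / (4 * T) with hθ
  have hθ0 : 0 < θ := by positivity
  have h2θ : 2 * θ < 1 / max T T := by
    rw [max_self, hθ, show 2 * (1 / (4 * T)) = 1 / (2 * T) by field_simp; ring,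
      div_lt_div_iff₀ (by positivity) hT]
    nlinarith
  obtain ⟨C, hC⟩ := hgb
  -- (1) the bound on `g'` everywhere
  have hg'b : ∀ z, |g' z| ≤ C * Real.exp (θ * H z) :=
    abs_le_of_ae_eq_of_continuous (B := fun z => C * Real.exp (θ * H z)) hg'c
      (continuous_const.mul (Real.continuous_exp.comp (continuous_const.mul hHc))) hC hae
  refine ⟨⟨C, hg'b⟩, ?_⟩
  have hC0 : 0 ≤ C := nonneg_of_mul_nonneg_left ((abs_nonneg _).trans (hg'b 0)) (Real.exp_pos _)
  -- (2) the new datum `f' = ψ + Q g'` and `ĝ = R f'`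
  set i0 : Fin L := ⟨0, hL0⟩ with hi0
  set f' : PhaseSpace L → ℝ := fun y => r⁻¹ * ((y.2 i0 ^ 2 - T) - c) +
    (L : ℝ)⁻¹ * ∑ i : Fin L, g' (momentumFlip i y) with hf'
  have hf'c : Continuous f' := by
    rw [hf']
    exact Continuous.add (by fun_prop)
      (continuous_const.mul (continuous_finsetSum _ fun i _ => hg'c.comp (continuous_momentumFlip i)))
  set C₁ : ℝ := r⁻¹ * (2 / θ + T + |c|) + C with hC₁
  have hf'b : ∀ y, |f' y| ≤ C₁ * Real.exp (θ * H y) := by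
    intro y
    have e1 : |y.2 i0 ^ 2 - T| ≤ (2 / θ + T) * Real.exp (θ * H y) :=
      abs_sq_momentum_sub_le_exp hω hl.le hβ.le hθ0 hT.le y i0
    have e2 : (1 : ℝ) ≤ Real.exp (θ * H y) := Real.one_le_exp (mul_nonneg hθ0.le (hH0 y))
    have e3 : |(L : ℝ)⁻¹ * ∑ i : Fin L, g' (momentumFlip i y)| ≤ C * Real.exp (θ * H y) := by
      rw [abs_mul, abs_of_pos (by positivity : (0 : ℝ) < (L : ℝ)⁻¹)]
      calc (L : ℝ)⁻¹ * |∑ i : Fin L, g' (momentumFlip i y)|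
          ≤ (L : ℝ)⁻¹ * ∑ _i : Fin L, C * Real.exp (θ * H y) := by
            refine mul_le_mul_of_nonneg_left ((Finset.abs_sum_le_sum_abs _ _).trans
              (Finset.sum_le_sum fun i _ => ?_)) (by positivity)
            have h := hg'b (momentumFlip i y)
            rwa [hH, OscillatorChain.hamiltonian_momentumFlip] at h
        _ = C * Real.exp (θ * H y) := by
            rw [Finset.sum_const, Finset.card_univ, Fintype.card_fin, nsmul_eq_mul, ← mul_assoc,
              inv_mul_cancel₀ (by positivity : (L : ℝ) ≠ 0), one_mul]
    have e4 : |r⁻¹ * ((y.2 i0 ^ 2 - T) - c)| ≤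
        r⁻¹ * ((2 / θ + T) * Real.exp (θ * H y) + |c| * Real.exp (θ * H y)) := by
      rw [abs_mul, abs_of_pos (inv_pos.2 hr)]
      refine mul_le_mul_of_nonneg_left ((abs_sub _ _).trans (add_le_add e1 ?_)) (inv_pos.2 hr).le
      exact le_mul_of_one_le_right (abs_nonneg c) e2
    rw [hf']
    dsimp only
    calc |r⁻¹ * ((y.2 i0 ^ 2 - T) - c) + (L : ℝ)⁻¹ * ∑ i : Fin L, g' (momentumFlip i y)|
        ≤ |r⁻¹ * ((y.2 i0 ^ 2 - T) - c)| + |(L : ℝ)⁻¹ * ∑ i : Fin L, g' (momentumFlip i y)| := abs_add_le _ _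
      _ ≤ r⁻¹ * ((2 / θ + T) * Real.exp (θ * H y) + |c| * Real.exp (θ * H y)) + C * Real.exp (θ * H y) :=
          add_le_add e4 e3
      _ = C₁ * Real.exp (θ * H y) := by rw [hC₁]; ring
  set ĝ : PhaseSpace L → ℝ := fun z => ∫ y, f' y ∂(R z) with hĝ
  have hĝc : Continuous ĝ :=
    pinnedChain_continuous_integral_resolventKernel_of_abs_le_exp hω hl hβ hγ hL1 hT hT hr hθ0 h2θ hf'c hf'b
  -- (3) `ĝ = g` Lebesgue-a.e.: `Q g' = Q g` a.e., transported through `μ_T R = μ_T ∼ volume`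
  have hQae : ∀ᵐ y ∂(volume : Measure (PhaseSpace L)),
      (L : ℝ)⁻¹ * ∑ i : Fin L, g' (momentumFlip i y) = (L : ℝ)⁻¹ * ∑ i : Fin L, g (momentumFlip i y) := by
    have h : ∀ i : Fin L, ∀ᵐ y ∂(volume : Measure (PhaseSpace L)),
        (g ∘ momentumFlip i) y = (g' ∘ momentumFlip i) y := fun i =>
      (measurePreserving_momentumFlip_volume i).quasiMeasurePreserving.ae_eq hae
    filter_upwards [ae_all_iff.2 h] with y hy
    congr 1
    exact Finset.sum_congr rfl fun i _ => (hy i).symm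
  set μT := P.gibbsMeasure L T with hμT
  haveI : IsProbabilityMeasure μT := pinnedChain_isProbabilityMeasure_gibbsMeasure hω hl.le hβ.le γ L hT
  have hμTac : μT ≪ volume := P.gibbsMeasure_absolutelyContinuous L T
  have hvolac : (volume : Measure (PhaseSpace L)) ≪ μT :=
    pinnedChain_volume_absolutelyContinuous_gibbsMeasure hω hl.le hβ.le γ L hT
  have hbind : μT.bind R = μT :=
    bind_resolventKernel_of_isInvariant Sg hr (pinnedChainSemigroup_isInvariant_gibbsMeasure hω hl.le hβ hγ hL0 hT)
  have hQaeR : ∀ᵐ z ∂μT, ∀ᵐ y ∂(R z),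
      (L : ℝ)⁻¹ * ∑ i : Fin L, g' (momentumFlip i y) = (L : ℝ)⁻¹ * ∑ i : Fin L, g (momentumFlip i y) := by
    refine Measure.ae_ae_of_ae_bind (Kernel.aemeasurable R) ?_
    rw [hbind]
    exact hμTac.ae_le hQae
  have hĝg : ∀ᵐ z ∂μT, ĝ z = g z := by
    filter_upwards [hQaeR] with z hz
    rw [hmild z, hĝ]
    refine integral_congr_ae ?_
    filter_upwards [hz] with y hy
    rw [hf']
    dsimp only
    rw [hy]
  -- (4) two continuous a.e.-equal functions coincide
  have hĝg' : ĝ = g' := by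
    haveI := isAddHaarMeasure_volume_phaseSpace L
    have h1 : ĝ =ᵐ[(volume : Measure (PhaseSpace L))] g := hvolac.ae_eq hĝg
    exact (Continuous.ae_eq_iff_eq volume hĝc hg'c).1 (h1.trans hae)
  -- (5) the mild equation for `g'`
  intro z
  exact (congr_fun hĝg' z).symm

end Upgrade

/-- Registered stub `stub_flipSmoothMildUpgrade` (UPGRADE) of line `fekete-usc-one-length`, crux
stmt-AtomisticToContinuum-11976: the continuous Lebesgue-a.e. representative `g'` of a measurable
`e^{H/(4T)}`-bounded solution `g` of the centred mild Poisson equation at equal bath temperatures `(T, T)` is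
`e^{H/(4T)}`-bounded everywhere and solves the same mild equation pointwise (`flip_smoothMildUpgrade`). -/
theorem stub_flipSmoothMildUpgrade :
    ∀ (ω₂ lam β γ : ℝ) (hω : 0 < ω₂) (hl : 0 < lam) (hβ : 0 < β) (hγ : 0 < γ) (L : ℕ) (hL : 2 ≤ L)
      (T : ℝ) (hT : 0 < T) (ε : ℝ), 0 < ε → ∀ (c : ℝ) (g g' : PhaseSpace L → ℝ), Measurable g →
      (∃ C : ℝ, ∀ z, |g z| ≤ C * Real.exp (1 / (4 * T) * (pinnedChain ω₂ lam β γ).hamiltonian L z)) →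
      (∀ z, g z = ∫ y, (((L : ℝ) * ε)⁻¹ * ((y.2 ⟨0, by omega⟩ ^ 2 - T) - c) +
          (L : ℝ)⁻¹ * ∑ i : Fin L, g (momentumFlip i y))
        ∂((pinnedChainSemigroup hω hl.le hβ.le hγ.le (by omega) hT.le hT.le).resolventKernel
          ((L : ℝ) * ε) z)) →
      Continuous g' → (∀ᵐ x ∂(volume : Measure (PhaseSpace L)), g x = g' x) →
      (∃ C : ℝ, ∀ z, |g' z| ≤ C * Real.exp (1 / (4 * T) * (pinnedChain ω₂ lam β γ).hamiltonian L z)) ∧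
      ∀ z, g' z = ∫ y, (((L : ℝ) * ε)⁻¹ * ((y.2 ⟨0, by omega⟩ ^ 2 - T) - c) +
          (L : ℝ)⁻¹ * ∑ i : Fin L, g' (momentumFlip i y))
        ∂((pinnedChainSemigroup hω hl.le hβ.le hγ.le (by omega) hT.le hT.le).resolventKernel
          ((L : ℝ) * ε) z) :=
  fun _ _ _ _ hω hl hβ hγ _ hL _ hT _ hε c _ _ _ hgb hmild hg'c hae =>
    flip_smoothMildUpgrade hω hl hβ hγ hL hT hε c hgb hmild hg'c hae

end Summit.AtomisticToContinuum.FouriersLaw.Theorems.VanishingNoiseBound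

end
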